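import Summits.AnomalousDissipation.AnomalousDissipation.Theorems.TwoAndHalfDTwohalfdThesisStubVorticityEquation
import Summits.AnomalousDissipation.AnomalousDissipation.Theorems.TwoAndHalfDTwohalfdThesisStubEnvelopedSourceVariance
import Summits.AnomalousDissipation.AnomalousDissipation.Theorems.TwoAndHalfDTwohalfdThesisStubPlanarCurlTools
import Literature.Analysis.FluidPDE.LerayHopfGalileanTorusMeans

/-!
# Q4 `stub_twinEnstrophyCeiling` — a uniform envelope for the torque pattern caps the mean enstrophy
# (line `Sketch`, crux stmt-AnomalousDissipation-0206)

Registered tool stub of the line `Sketch` (duhamel-release) for the crux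
`Summit.AnomalousDissipation.AnomalousDissipation.Theses.TwoAndHalfD.TwohalfdThesis`
(stmt-AnomalousDissipation-0206), section Q (SELECTIVITY OF THE WITNESS'S MIXING) of the skeleton
`Cruxes/TwohalfdThesis/Lines/Sketch.lean`, assembling the three landed tool stubs of this cycle:

* Q1 `stub_vorticityEquation` (p143927): Prandtl number one — the planar vorticity
  `ω(t) = ∂₀v₁(t) − ∂₁v₀(t)` of a classical solution of the steadily forced planar Navier–Stokes system
  on `[0, ∞) × T²` is a classical solution of the SOURCED scalar equation
  `∂ₜω + v·∇ω = νΔω + curl g` over the same drift with the same diffusivity;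
* Q2 `stub_envelopedSourceVariance` (p144767): Duhamel with datum — a classical steadily sourced
  scalar whose releases from every late time carry ONE integrable `L²` envelope of mass `≤ M` has
  honest `limsup`-mean variance `≤ M²‖source‖²`, whatever its mean-zero datum;
* Q3 `stub_planarCurlTools` (p145693): vorticity slices have zero mean, and `‖∇v‖₂² = ‖curl v‖₂²` for smooth
  divergence-free planar fields (spectral `Torus.eGradNormSq`, the currency of the strain gate).

Result `stub_twinEnstrophyCeiling`: if the classical releases `ψ s` of the torque pattern `curl g` from
every `s ≥ s₀ ≥ 0` obey `‖ψ s (t)‖² ≤ Λ(t−s)²‖curl g‖²` with `Λ ≥ 0`, `∫₀^∞ Λ ≤ M`, then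
`⟨‖∇v‖₂²⟩ ≤ M²‖curl g‖₂²` — a torque envelope is an ENSTROPHY CEILING, uniform in everything but
`M` and `‖curl g‖`.  The lead's non-selective no-go (Q5) plays this ceiling against the strain gate's
`log²(1/ν)` floor.  Supports stmt-AnomalousDissipation-0206. [folklore: Majda–Bertozzi 2002 §2.1 (vorticity
equation); Duhamel]
-/

noncomputable section

-- the summit path `AnomalousDissipation/AnomalousDissipation` duplicates a namespace component
set_option linter.dupNamespace false

namespace Summit.AnomalousDissipation.AnomalousDissipation.Theorems.TwohalfdThesis

open MeasureTheory Set Filter Topology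
open scoped ENNReal NNReal InnerProductSpace
open Literature.Analysis.FunctionSpaces Literature.Analysis.FluidPDE

/-- **Q4 `stub_twinEnstrophyCeiling` (line `Sketch` = duhamel-release, crux `TwoAndHalfD.TwohalfdThesis`;
registered signature) — a uniform envelope for the torque pattern caps the mean enstrophy.**  For a
classical solution `(v, p)` of the planar Navier–Stokes system on `[0, ∞) × T²` with steady smooth force
`g` and `ν > 0`: if the classical releases `ψ s` of `curl g` from every `s ≥ s₀ ≥ 0` obey
`‖ψ s (t)‖² ≤ Λ(t−s)²‖curl g‖²` (`s₀ ≤ s ≤ t`) with `Λ ≥ 0`, `∫₀^∞ Λ ≤ M`, then the honest `limsup` mean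
enstrophy satisfies `⟨‖∇v‖₂²⟩ ≤ M²‖curl g‖₂²`.  PROOF: the vorticity `ω = ∂₀v₁ − ∂₁v₀` is the sourced
scalar with source `curl g` (Q1), its slice `ω(s₀)` has zero mean (Q3 (i)), so Q2 caps `⟨‖ω‖²⟩` by
`M²‖curl g‖²`; on the smooth divergence-free slices `t > 0` the enstrophy `(eGradNormSq (v t)).toReal`
equals `‖ω(t)‖²` (Q3 (ii)), and long-time means only see `t > 0` (`longTimeAvgSup_congr_of_eqOn_Ioi`). [folklore] -/
theorem stub_twinEnstrophyCeiling :
    ∀ (ν s₀ M : ℝ) (g : (UnitAddTorus (Fin 2)) → (EuclideanSpace ℝ (Fin 2)))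
      (v : ℝ → (UnitAddTorus (Fin 2)) → (EuclideanSpace ℝ (Fin 2))) (p : ℝ → (UnitAddTorus (Fin 2)) → ℝ)
      (ψ : ℝ → ℝ → (UnitAddTorus (Fin 2)) → ℝ) (Λ : ℝ → ℝ),
      0 < ν → Torus.IsSmooth g → Torus.IsClassicalNSSolutionOn (Ici 0) ν (fun _ => g) v p → 0 ≤ s₀ →
      (∀ s, s₀ ≤ s → Torus.IsClassicalScalarTransportOn (Ici s) ν v (ψ s) ∧
          ψ s s = fun x => Torus.partialDeriv 0 g x 1 - Torus.partialDeriv 1 g x 0) →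
      (∀ τ, 0 ≤ Λ τ) → IntegrableOn Λ (Ici 0) → (∫ τ in Ici 0, Λ τ) ≤ M →
      (∀ s t, s₀ ≤ s → s ≤ t → Torus.scalarL2Sq (ψ s t) ≤
          Λ (t - s) ^ 2 * Torus.scalarL2Sq (fun x => Torus.partialDeriv 0 g x 1 - Torus.partialDeriv 1 g x 0)) →
      longTimeAvgSup (fun t => (Torus.eGradNormSq (v t)).toReal) ≤
        M ^ 2 * Torus.scalarL2Sq (fun x => Torus.partialDeriv 0 g x 1 - Torus.partialDeriv 1 g x 0) := by
  intro ν s₀ M g v p ψ Λ hν hg hNS hs₀ hψ hΛ0 hΛi hΛM henv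
  -- the torque pattern and the vorticity
  set G : UnitAddTorus (Fin 2) → ℝ := fun x => Torus.partialDeriv 0 g x 1 - Torus.partialDeriv 1 g x 0 with hGdef
  set ω : ℝ → UnitAddTorus (Fin 2) → ℝ :=
    fun t x => Torus.partialDeriv 0 (v t) x 1 - Torus.partialDeriv 1 (v t) x 0 with hωdef
  have hGs : Torus.IsSmooth G := ((hg.partialDeriv 0).apply 1).sub ((hg.partialDeriv 1).apply 0)
  -- Q1: the vorticity is the sourced scalar with source `curl g`
  have hω : Torus.IsClassicalScalarTransportForcedOn (Ici 0) ν v (fun _ => G) ω :=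
    stub_vorticityEquation ν g v p hg hNS
  -- Q3 (i): the slice `ω(s₀)` has zero mean
  have hvs₀ : Torus.IsSmooth (v s₀) := hNS.smooth_velocity.isSmooth_slice (mem_Ici.2 hs₀)
  have hω0 : Torus.HasZeroMean (ω s₀) := stub_planarCurlTools.1 (v s₀) hvs₀
  -- Q2: the variance ceiling for the vorticity
  have hvar : longTimeAvgSup (fun t => Torus.scalarL2Sq (ω t)) ≤ M ^ 2 * Torus.scalarL2Sq G :=
    stub_envelopedSourceVariance ν s₀ M v G ω ψ Λ hν hGs hs₀ hω hω0 hψ hΛ0 hΛi hΛM henv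
  -- Q3 (ii): enstrophy = ‖curl‖² on the smooth divergence-free slices `t > 0`
  have hcongr : longTimeAvgSup (fun t => (Torus.eGradNormSq (v t)).toReal) =
      longTimeAvgSup (fun t => Torus.scalarL2Sq (ω t)) := by
    refine longTimeAvgSup_congr_of_eqOn_Ioi fun t ht => ?_
    have hvt : Torus.IsSmooth (v t) := hNS.smooth_velocity.isSmooth_slice (mem_Ici.2 ht.le)
    exact stub_planarCurlTools.2 (v t) hvt (hNS.divFree t (mem_Ici.2 ht.le))
  rw [hcongr]
  exact hvar

end Summit.AnomalousDissipation.AnomalousDissipation.Theorems.TwohalfdThesis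

end
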